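import Summits.QuantumFields.BalabanUV.Beta.GAN24.StencilSlotE3RateOfPieces
import Summits.QuantumFields.BalabanUV.Beta.GAN24.StencilSlotOfE3

/-!
# `BalabanUV.Beta.GAN24.StencilSlotE3Tables` — binder row G-an2-4 / (CONV-C), S-slot, road «S3»: THE TWO LOCATED SHAPES «E3Shape» ∧ «E3SupRate»
# FROM TWELVE ROWS — seven SHAPE rows and five depth-paired DIFFERENCE rows (the size rows and the member-2-vs-1 row of the RATE table are
# DERIVED here; row owner b2b-balaban-gan24-p1, gen 4)

NOT IN PRINT; OUR PROOF ATTEMPT.  HONEST FRAMING (cell contract, verbatim): «discharging `BetaPertH` makes Bałaban's UV stability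
UNCONDITIONAL — a real constructive-QFT result; it is NOT the continuum limit and NOT the Clay problem.»  HONEST DEPENDENCY (verbatim):
«continuum YM on T⁴ ⇐ BetaPertH ∧ nine spine estimates (0/9 proved); BetaPertH ⇐ (D1) ∧ (D4) ∧ CAP+tail; G-an2-4 gates asym, D1 and
NE2/3/4.»  [folklore] composition of `StencilSlotE3OfPieces.e3Shape_of_pieces` and `StencilSlotE3RateOfPieces.e3SupRate_of_pieces` BY NAME;
0 `def`, 0 cite, 0 `Prop` mirror, 0 sorry.  Discharges NOTHING of the twelve rows, hence nothing of (hS, hSall); NOT BetaPertH, NOT continuum, NOT Clay.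

## What is proved (generic `d`, `Lc ≥ 1`)
* (a `LocStencil` bound is a sup bound: pv's `KernelWard.bdd_of_biLoc`, BY NAME.)
* `supBound_members_two_one` — the RATE table's row h0 needs NO hypothesis: members `2` and `1` are each sup-bounded by an2's `locStencil_e3Of`.
* **`e3Shape_and_supRate_of_rows`** — «E3Shape» ∧ «E3SupRate» (literally the pair consumed by `StencilSlotSupRate.e3Drift_of_shape_supRate`) from
  the SEVEN SHAPE rows (W, V0, Λ0, Vt, Λt, V, Λ — `LocStencil`, one rate `δ`, one ratio `θ`) and the FIVE DIFFERENCE rows (dW, dVt, dLt, dV, dL —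
  `SupBound`, paired by depth, ratios `θ` and `ρ`).  The S3 table of record therefore has 12 analytic rows.
* **`e3Shape_and_drift_of_rows`** (§2) — the same twelve rows ⇒ «E3Shape» ∧ «E3Drift» with rate data `0 < √θ < 1`, `0 < δ₃/2`: EXACTLY the
  hypotheses of `StencilSlotOfE3.hSall_of_e3` ∕ `StencilSlotWallPlug.hS_hSall_of_e3` ∕ `d1Drift_JsBalOf_iff_of_e3Shapes` (`d = 3`, `Lc ≥ 2`).
* **`hS_hSall_of_rows`** (§3, `d = 3`, `Lc ≥ 2`) — the wall's S-rows `(hS, hSall)` (the literal conclusion shape of `StencilSlotWallPlug.hS_hSall_of_e3`)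
  from the twelve rows ALONE (K-slot inside by `KSlotAssembly.convCKWall_holds`).
-/

noncomputable section

open Finset
open scoped BigOperators
open Literature.MathematicalPhysics.QuantumFieldTheory
open Literature.MathematicalPhysics.QuantumFieldTheory.Balaban1983to89
open Literature.MathematicalPhysics.QuantumFieldTheory.Balaban1983to89.Beta
open ExpKernelCalculus (MKer BiLoc VertexFamily₂)
open OneStepResolventKernel (Fib LocStencil KInv)
open StepJetData (wilsonA mfNeg locStencil_smul)
open AveragingHessianKernels (vhS hessFF)
open InterLevelTransport (SLam)
open BalabanStepJets (lamCoeffOf locStencil_mono)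
open BalabanCompositeJets (pushSum borderInc lagrInc)
open BalabanStepJetsSucc (e3Of wE locStencil_e3Of JsBal0Of)
open B12Sec2to5 (l1 l1_nonneg)
open KernelWard (bdd_of_biLoc)
open Summit.QuantumFields.BalabanUV.Beta.HessKerDressedUnits (unitS)
open Summit.QuantumFields.BalabanUV.Beta.GAN24.CombesThomas (SupBound sfStep smStep)
open Summit.QuantumFields.BalabanUV.Beta.GAN24.E3UnitSplit (e3OfS)
open Summit.QuantumFields.BalabanUV.Beta.GAN24.StencilSlotE3OfPieces (unitS_e3Of e3Shape_of_pieces)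
open Summit.QuantumFields.BalabanUV.Beta.GAN24.StencilSlotE3RateOfPieces (e3SupRate_of_pieces)
open Summit.QuantumFields.BalabanUV.Beta.GAN24.StencilSlotOfE3 (one_le_of_two_le hS_of_e3 hSall_of_e3)
open Summit.QuantumFields.BalabanUV.Beta.GAN24.StencilSlotSupRate (e3Drift_of_shape_supRate)

namespace Summit.QuantumFields.BalabanUV.Beta.GAN24.StencilSlotE3Tables

variable {d : ℕ} {Lc : ℕ} [NeZero Lc]

/-- [folklore] **ROW h0 OF THE RATE TABLE IS FREE**: the normalised third-jet summands of members `2` and `1` are each sup-bounded (an2's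
`locStencil_e3Of` at `j = 2` and `j = 1`, via `unitS_e3Of`), hence so is their difference. -/
theorem supBound_members_two_one (hLc : 1 ≤ Lc) (cE cVH cΛ : ℝ) :
    ∃ c₀₀ : ℝ, ∀ (κ : Fin (d + 1)) (u : Fin (d + 1) → ℤ),
      SupBound (unitS (sfStep Lc 2) (smStep d Lc 2) (fun κ u => (cE * wE d Lc 2) • e3Of d Lc cE cVH cΛ 2 κ u) κ u -
        unitS (sfStep Lc 1) (smStep d Lc 1) (fun κ u => (cE * wE d Lc 1) • e3Of d Lc cE cVH cΛ 1 κ u) κ u) c₀₀ := by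
  obtain ⟨C₁, δ₁, hδ₁, h1⟩ := locStencil_e3Of (d := d) (Lc := Lc) hLc cE cVH cΛ 1
  obtain ⟨C₂, δ₂, hδ₂, h2⟩ := locStencil_e3Of (d := d) (Lc := Lc) hLc cE cVH cΛ 2
  refine ⟨|cE * ((Lc : ℝ) ^ 2) ^ (2 * (d + 1))| * C₂ + |cE * ((Lc : ℝ) ^ 1) ^ (2 * (d + 1))| * C₁, fun κ u => ?_⟩
  rw [unitS_e3Of cE cVH cΛ 1, unitS_e3Of cE cVH cΛ 0]
  have b2 := bdd_of_biLoc ((locStencil_smul (cE * ((Lc : ℝ) ^ (1 + 1)) ^ (2 * (d + 1))) h2) κ u) hδ₂.le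
  have b1 := bdd_of_biLoc ((locStencil_smul (cE * ((Lc : ℝ) ^ (0 + 1)) ^ (2 * (d + 1))) h1) κ u) hδ₁.le
  intro x y a b
  simp only [Pi.sub_apply]
  exact le_trans (abs_sub _ _) (add_le_add (b2 x y a b) (b1 x y a b))

/-- **«E3Shape» ∧ «E3SupRate» FROM THE TWELVE ROWS** [folklore composition]: the seven SHAPE rows of `e3Shape_of_pieces` (one rate `δ > 0`, one
ratio `0 ≤ θ < 1`) and the five depth-paired DIFFERENCE rows of `e3SupRate_of_pieces` (ratios `θ` and `0 ≤ ρ < 1`); the RATE table's size rows are the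
sup shadows of SHAPE rows V0∕Λ0∕V∕Λ (`KernelWard.bdd_of_biLoc`) and its row h0 is `supBound_members_two_one`.  OUTPUT: the pair («E3Shape», «E3SupRate»)
in the literal forms of `StencilSlotOfShapes.hS_of_shapes` ∕ `StencilSlotSupRate.e3Drift_of_shape_supRate`. -/
theorem e3Shape_and_supRate_of_rows (hLc : 1 ≤ Lc) (cE cVH cΛ : ℝ)
    {δ θ ρ CW c₀V c₀L CtV CtL cV cL eW eVt eLt eV eL : ℝ} (hδ : 0 < δ) (hθ0 : 0 ≤ θ) (hθ1 : θ < 1) (hρ0 : 0 ≤ ρ) (hρ1 : ρ < 1)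
    (hW : ∀ n : ℕ, LocStencil (fun κ' u' x' z' a b => ((Lc : ℝ) ^ (n + 1 + 1)) ^ (2 * (d + 1)) *
      e3OfS (Lc ^ (n + 1 + 1)) (fun κ u => (cE * ((Lc : ℝ) ^ (d + 1)) ^ (n + 1)) • wilsonA d κ u) κ' u' x' z' a b) CW δ)
    (hV0 : ∀ n : ℕ, LocStencil (fun κ' u' x' z' a b => ((Lc : ℝ) ^ (n + 1 + 1)) ^ (2 * (d + 1)) *
      e3OfS (Lc ^ (n + 1 + 1)) (fun κ u => (((Lc : ℝ) ^ (d + 1)) ^ (n + 1) * cVH) • pushSum Lc (Lc ^ (n + 1)) (mfNeg (vhS d Lc κ u)))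
        κ' u' x' z' a b) (c₀V * θ ^ (n + 1)) δ)
    (hL0 : ∀ n : ℕ, LocStencil (fun κ' u' x' z' a b => ((Lc : ℝ) ^ (n + 1 + 1)) ^ (2 * (d + 1)) *
      e3OfS (Lc ^ (n + 1 + 1)) (fun κ u => (((Lc : ℝ) ^ (d + 1)) ^ (n + 1) * cΛ) •
        SLam Lc (lamCoeffOf (KInv (N := Lc) (d := d)) Lc) (fun μ y => hessFF Lc μ y) κ u) κ' u' x' z' a b) (c₀L * θ ^ (n + 1)) δ)
    (hVt : ∀ n : ℕ, LocStencil (fun κ' u' x' z' a b => ((Lc : ℝ) ^ (n + 1 + 1)) ^ (2 * (d + 1)) *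
      e3OfS (Lc ^ (n + 1 + 1)) (fun κ u => (cVH * ((Lc : ℝ) ^ (n + 1)) ^ (d + 2)) • borderInc d Lc (Lc ^ (n + 1)) κ u)
        κ' u' x' z' a b) CtV δ)
    (hLt : ∀ n : ℕ, LocStencil (fun κ' u' x' z' a b => ((Lc : ℝ) ^ (n + 1 + 1)) ^ (2 * (d + 1)) *
      e3OfS (Lc ^ (n + 1 + 1)) (fun κ u => (cΛ * ((Lc : ℝ) ^ (n + 1)) ^ (2 * d + 4)) •
        lagrInc d Lc (Lc ^ (n + 1)) (Lc ^ (n + 1 + 1)) κ u) κ' u' x' z' a b) CtL δ)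
    (hV : ∀ n m : ℕ, m < n → LocStencil (fun κ' u' x' z' a b => ((Lc : ℝ) ^ (n + 1 + 1)) ^ (2 * (d + 1)) *
      e3OfS (Lc ^ (n + 1 + 1)) (fun κ u => (((Lc : ℝ) ^ (d + 1)) ^ (n - m) * (cVH * ((Lc : ℝ) ^ (m + 1)) ^ (d + 2))) •
        pushSum (Lc ^ (m + 1 + 1)) (Lc ^ (n - m)) (borderInc d Lc (Lc ^ (m + 1)) κ u)) κ' u' x' z' a b) (cV * θ ^ (n - m)) δ)
    (hL : ∀ n m : ℕ, m < n → LocStencil (fun κ' u' x' z' a b => ((Lc : ℝ) ^ (n + 1 + 1)) ^ (2 * (d + 1)) *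
      e3OfS (Lc ^ (n + 1 + 1)) (fun κ u => (((Lc : ℝ) ^ (d + 1)) ^ (n - m) * (cΛ * ((Lc : ℝ) ^ (m + 1)) ^ (2 * d + 4))) •
        lagrInc d Lc (Lc ^ (m + 1)) (Lc ^ (m + 1 + 1)) κ u) κ' u' x' z' a b) (cL * θ ^ (n - m)) δ)
    (dW : ∀ (n : ℕ) (κ' : Fin (d + 1)) (u' : Fin (d + 1) → ℤ), SupBound (fun x z a b =>
      ((Lc : ℝ) ^ (n + 1 + 1 + 1)) ^ (2 * (d + 1)) * e3OfS (Lc ^ (n + 1 + 1 + 1)) (fun κ u => (cE * ((Lc : ℝ) ^ (d + 1)) ^ (n + 1 + 1)) • wilsonA d κ u) κ' u' x z a b -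
      ((Lc : ℝ) ^ (n + 1 + 1)) ^ (2 * (d + 1)) * e3OfS (Lc ^ (n + 1 + 1)) (fun κ u => (cE * ((Lc : ℝ) ^ (d + 1)) ^ (n + 1)) • wilsonA d κ u) κ' u' x z a b) (eW * θ ^ (n + 1)))
    (dVt : ∀ (n : ℕ) (κ' : Fin (d + 1)) (u' : Fin (d + 1) → ℤ), SupBound (fun x z a b =>
      ((Lc : ℝ) ^ (n + 1 + 1 + 1)) ^ (2 * (d + 1)) * e3OfS (Lc ^ (n + 1 + 1 + 1)) (fun κ u => (cVH * ((Lc : ℝ) ^ (n + 1 + 1)) ^ (d + 2)) • borderInc d Lc (Lc ^ (n + 1 + 1)) κ u) κ' u' x z a b -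
      ((Lc : ℝ) ^ (n + 1 + 1)) ^ (2 * (d + 1)) * e3OfS (Lc ^ (n + 1 + 1)) (fun κ u => (cVH * ((Lc : ℝ) ^ (n + 1)) ^ (d + 2)) • borderInc d Lc (Lc ^ (n + 1)) κ u) κ' u' x z a b) (eVt * θ ^ (n + 1)))
    (dLt : ∀ (n : ℕ) (κ' : Fin (d + 1)) (u' : Fin (d + 1) → ℤ), SupBound (fun x z a b =>
      ((Lc : ℝ) ^ (n + 1 + 1 + 1)) ^ (2 * (d + 1)) * e3OfS (Lc ^ (n + 1 + 1 + 1)) (fun κ u => (cΛ * ((Lc : ℝ) ^ (n + 1 + 1)) ^ (2 * d + 4)) •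
        lagrInc d Lc (Lc ^ (n + 1 + 1)) (Lc ^ (n + 1 + 1 + 1)) κ u) κ' u' x z a b -
      ((Lc : ℝ) ^ (n + 1 + 1)) ^ (2 * (d + 1)) * e3OfS (Lc ^ (n + 1 + 1)) (fun κ u => (cΛ * ((Lc : ℝ) ^ (n + 1)) ^ (2 * d + 4)) •
        lagrInc d Lc (Lc ^ (n + 1)) (Lc ^ (n + 1 + 1)) κ u) κ' u' x z a b) (eLt * θ ^ (n + 1)))
    (dV : ∀ (n m : ℕ), m < n → ∀ (κ' : Fin (d + 1)) (u' : Fin (d + 1) → ℤ), SupBound (fun x z a b =>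
      ((Lc : ℝ) ^ (n + 1 + 1 + 1)) ^ (2 * (d + 1)) * e3OfS (Lc ^ (n + 1 + 1 + 1)) (fun κ u => ((((Lc : ℝ) ^ (d + 1)) ^ (n - m) * (cVH * ((Lc : ℝ) ^ (m + 1 + 1)) ^ (d + 2))) •
        pushSum (Lc ^ (m + 1 + 1 + 1)) (Lc ^ (n - m)) (borderInc d Lc (Lc ^ (m + 1 + 1)) κ u))) κ' u' x z a b -
      ((Lc : ℝ) ^ (n + 1 + 1)) ^ (2 * (d + 1)) * e3OfS (Lc ^ (n + 1 + 1)) (fun κ u => ((((Lc : ℝ) ^ (d + 1)) ^ (n - m) * (cVH * ((Lc : ℝ) ^ (m + 1)) ^ (d + 2))) •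
        pushSum (Lc ^ (m + 1 + 1)) (Lc ^ (n - m)) (borderInc d Lc (Lc ^ (m + 1)) κ u))) κ' u' x z a b) (eV * θ ^ (n + 1) * ρ ^ (n - m)))
    (dL : ∀ (n m : ℕ), m < n → ∀ (κ' : Fin (d + 1)) (u' : Fin (d + 1) → ℤ), SupBound (fun x z a b =>
      ((Lc : ℝ) ^ (n + 1 + 1 + 1)) ^ (2 * (d + 1)) * e3OfS (Lc ^ (n + 1 + 1 + 1)) (fun κ u => ((((Lc : ℝ) ^ (d + 1)) ^ (n - m) * (cΛ * ((Lc : ℝ) ^ (m + 1 + 1)) ^ (2 * d + 4))) •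
        lagrInc d Lc (Lc ^ (m + 1 + 1)) (Lc ^ (m + 1 + 1 + 1)) κ u)) κ' u' x z a b -
      ((Lc : ℝ) ^ (n + 1 + 1)) ^ (2 * (d + 1)) * e3OfS (Lc ^ (n + 1 + 1)) (fun κ u => ((((Lc : ℝ) ^ (d + 1)) ^ (n - m) * (cΛ * ((Lc : ℝ) ^ (m + 1)) ^ (2 * d + 4))) •
        lagrInc d Lc (Lc ^ (m + 1)) (Lc ^ (m + 1 + 1)) κ u)) κ' u' x z a b) (eL * θ ^ (n + 1) * ρ ^ (n - m))) :
    (∃ C₃ δ₃ : ℝ, 0 < δ₃ ∧ ∀ j : ℕ, LocStencil (unitS (sfStep Lc (j + 1)) (smStep d Lc (j + 1))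
      (fun κ u => (cE * wE d Lc (j + 1)) • e3Of d Lc cE cVH cΛ (j + 1) κ u)) C₃ δ₃) ∧
    (∃ c : ℝ, 0 ≤ c ∧ ∀ (j : ℕ) (κ : Fin (d + 1)) (u : Fin (d + 1) → ℤ),
      SupBound (unitS (sfStep Lc (j + 2)) (smStep d Lc (j + 2)) (fun κ u => (cE * wE d Lc (j + 2)) • e3Of d Lc cE cVH cΛ (j + 2) κ u) κ u -
        unitS (sfStep Lc (j + 1)) (smStep d Lc (j + 1)) (fun κ u => (cE * wE d Lc (j + 1)) • e3Of d Lc cE cVH cΛ (j + 1) κ u) κ u) (c * θ ^ j)) := by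
  refine ⟨e3Shape_of_pieces hLc cE cVH cΛ hδ hθ0 hθ1 hW hV0 hL0 hVt hLt hV hL, ?_⟩
  obtain ⟨c₀₀, h0⟩ := supBound_members_two_one (d := d) (Lc := Lc) hLc cE cVH cΛ
  have hc₀₀ : 0 ≤ c₀₀ := (h0 0 0).nonneg (Sum.inl 0)
  refine ⟨max c₀₀ (|cE| * (eW + eVt + eLt + 2 * |c₀V| + 2 * |c₀L| + |cV| + |cL| + (|eV| + |eL|) * (ρ / (1 - ρ)))),
    le_max_of_le_left hc₀₀, fun j κ u => ?_⟩
  exact e3SupRate_of_pieces hLc cE cVH cΛ hθ0 hθ1 hρ0 hρ1 h0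
    (fun n κ' u' x y a b => bdd_of_biLoc ((hV0 n) κ' u') hδ.le x y a b)
    (fun n κ' u' x y a b => bdd_of_biLoc ((hL0 n) κ' u') hδ.le x y a b)
    (fun n m hm κ' u' x y a b => bdd_of_biLoc ((hV n m hm) κ' u') hδ.le x y a b)
    (fun n m hm κ' u' x y a b => bdd_of_biLoc ((hL n m hm) κ' u') hδ.le x y a b)
    dW dVt dLt dV dL j κ u

/-! ## §2 The pair consumed by the wall plug: «E3Shape» ∧ «E3Drift» (with its rate data) from the twelve rows -/

/-- **«E3Shape» ∧ «E3Drift» FROM THE TWELVE ROWS** (generic `d`, `Lc ≥ 1`; `0 < θ` for the `√θ` interpolation) [folklore composition]: §1, then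
`StencilSlotSupRate.e3Drift_of_shape_supRate` (drift constant `√(2(c/(1−θ))C₃)·(√θ)^k`, locality `δ₃/2`).  OUTPUT = exactly the hypotheses
`(hE3, hE3d, 0 < θ₃, θ₃ < 1, 0 < δ₃)` of `StencilSlotOfE3.hSall_of_e3` ∕ leaf-06's `StencilSlotWallPlug.hS_hSall_of_e3` and
`d1Drift_JsBalOf_iff_of_e3Shapes` (at `d = 3`, `Lc ≥ 2`, where the K-slot is inside): the wall's S-rows are then three `obtain`s away. -/
theorem e3Shape_and_drift_of_rows (hLc : 1 ≤ Lc) (cE cVH cΛ : ℝ)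
    {δ θ ρ CW c₀V c₀L CtV CtL cV cL eW eVt eLt eV eL : ℝ} (hδ : 0 < δ) (hθ0 : 0 < θ) (hθ1 : θ < 1) (hρ0 : 0 ≤ ρ) (hρ1 : ρ < 1)
    (hW : ∀ n : ℕ, LocStencil (fun κ' u' x' z' a b => ((Lc : ℝ) ^ (n + 1 + 1)) ^ (2 * (d + 1)) *
      e3OfS (Lc ^ (n + 1 + 1)) (fun κ u => (cE * ((Lc : ℝ) ^ (d + 1)) ^ (n + 1)) • wilsonA d κ u) κ' u' x' z' a b) CW δ)
    (hV0 : ∀ n : ℕ, LocStencil (fun κ' u' x' z' a b => ((Lc : ℝ) ^ (n + 1 + 1)) ^ (2 * (d + 1)) *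
      e3OfS (Lc ^ (n + 1 + 1)) (fun κ u => (((Lc : ℝ) ^ (d + 1)) ^ (n + 1) * cVH) • pushSum Lc (Lc ^ (n + 1)) (mfNeg (vhS d Lc κ u)))
        κ' u' x' z' a b) (c₀V * θ ^ (n + 1)) δ)
    (hL0 : ∀ n : ℕ, LocStencil (fun κ' u' x' z' a b => ((Lc : ℝ) ^ (n + 1 + 1)) ^ (2 * (d + 1)) *
      e3OfS (Lc ^ (n + 1 + 1)) (fun κ u => (((Lc : ℝ) ^ (d + 1)) ^ (n + 1) * cΛ) •
        SLam Lc (lamCoeffOf (KInv (N := Lc) (d := d)) Lc) (fun μ y => hessFF Lc μ y) κ u) κ' u' x' z' a b) (c₀L * θ ^ (n + 1)) δ)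
    (hVt : ∀ n : ℕ, LocStencil (fun κ' u' x' z' a b => ((Lc : ℝ) ^ (n + 1 + 1)) ^ (2 * (d + 1)) *
      e3OfS (Lc ^ (n + 1 + 1)) (fun κ u => (cVH * ((Lc : ℝ) ^ (n + 1)) ^ (d + 2)) • borderInc d Lc (Lc ^ (n + 1)) κ u)
        κ' u' x' z' a b) CtV δ)
    (hLt : ∀ n : ℕ, LocStencil (fun κ' u' x' z' a b => ((Lc : ℝ) ^ (n + 1 + 1)) ^ (2 * (d + 1)) *
      e3OfS (Lc ^ (n + 1 + 1)) (fun κ u => (cΛ * ((Lc : ℝ) ^ (n + 1)) ^ (2 * d + 4)) •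
        lagrInc d Lc (Lc ^ (n + 1)) (Lc ^ (n + 1 + 1)) κ u) κ' u' x' z' a b) CtL δ)
    (hV : ∀ n m : ℕ, m < n → LocStencil (fun κ' u' x' z' a b => ((Lc : ℝ) ^ (n + 1 + 1)) ^ (2 * (d + 1)) *
      e3OfS (Lc ^ (n + 1 + 1)) (fun κ u => (((Lc : ℝ) ^ (d + 1)) ^ (n - m) * (cVH * ((Lc : ℝ) ^ (m + 1)) ^ (d + 2))) •
        pushSum (Lc ^ (m + 1 + 1)) (Lc ^ (n - m)) (borderInc d Lc (Lc ^ (m + 1)) κ u)) κ' u' x' z' a b) (cV * θ ^ (n - m)) δ)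
    (hL : ∀ n m : ℕ, m < n → LocStencil (fun κ' u' x' z' a b => ((Lc : ℝ) ^ (n + 1 + 1)) ^ (2 * (d + 1)) *
      e3OfS (Lc ^ (n + 1 + 1)) (fun κ u => (((Lc : ℝ) ^ (d + 1)) ^ (n - m) * (cΛ * ((Lc : ℝ) ^ (m + 1)) ^ (2 * d + 4))) •
        lagrInc d Lc (Lc ^ (m + 1)) (Lc ^ (m + 1 + 1)) κ u) κ' u' x' z' a b) (cL * θ ^ (n - m)) δ)
    (dW : ∀ (n : ℕ) (κ' : Fin (d + 1)) (u' : Fin (d + 1) → ℤ), SupBound (fun x z a b =>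
      ((Lc : ℝ) ^ (n + 1 + 1 + 1)) ^ (2 * (d + 1)) * e3OfS (Lc ^ (n + 1 + 1 + 1)) (fun κ u => (cE * ((Lc : ℝ) ^ (d + 1)) ^ (n + 1 + 1)) • wilsonA d κ u) κ' u' x z a b -
      ((Lc : ℝ) ^ (n + 1 + 1)) ^ (2 * (d + 1)) * e3OfS (Lc ^ (n + 1 + 1)) (fun κ u => (cE * ((Lc : ℝ) ^ (d + 1)) ^ (n + 1)) • wilsonA d κ u) κ' u' x z a b) (eW * θ ^ (n + 1)))
    (dVt : ∀ (n : ℕ) (κ' : Fin (d + 1)) (u' : Fin (d + 1) → ℤ), SupBound (fun x z a b =>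
      ((Lc : ℝ) ^ (n + 1 + 1 + 1)) ^ (2 * (d + 1)) * e3OfS (Lc ^ (n + 1 + 1 + 1)) (fun κ u => (cVH * ((Lc : ℝ) ^ (n + 1 + 1)) ^ (d + 2)) • borderInc d Lc (Lc ^ (n + 1 + 1)) κ u) κ' u' x z a b -
      ((Lc : ℝ) ^ (n + 1 + 1)) ^ (2 * (d + 1)) * e3OfS (Lc ^ (n + 1 + 1)) (fun κ u => (cVH * ((Lc : ℝ) ^ (n + 1)) ^ (d + 2)) • borderInc d Lc (Lc ^ (n + 1)) κ u) κ' u' x z a b) (eVt * θ ^ (n + 1)))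
    (dLt : ∀ (n : ℕ) (κ' : Fin (d + 1)) (u' : Fin (d + 1) → ℤ), SupBound (fun x z a b =>
      ((Lc : ℝ) ^ (n + 1 + 1 + 1)) ^ (2 * (d + 1)) * e3OfS (Lc ^ (n + 1 + 1 + 1)) (fun κ u => (cΛ * ((Lc : ℝ) ^ (n + 1 + 1)) ^ (2 * d + 4)) •
        lagrInc d Lc (Lc ^ (n + 1 + 1)) (Lc ^ (n + 1 + 1 + 1)) κ u) κ' u' x z a b -
      ((Lc : ℝ) ^ (n + 1 + 1)) ^ (2 * (d + 1)) * e3OfS (Lc ^ (n + 1 + 1)) (fun κ u => (cΛ * ((Lc : ℝ) ^ (n + 1)) ^ (2 * d + 4)) •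
        lagrInc d Lc (Lc ^ (n + 1)) (Lc ^ (n + 1 + 1)) κ u) κ' u' x z a b) (eLt * θ ^ (n + 1)))
    (dV : ∀ (n m : ℕ), m < n → ∀ (κ' : Fin (d + 1)) (u' : Fin (d + 1) → ℤ), SupBound (fun x z a b =>
      ((Lc : ℝ) ^ (n + 1 + 1 + 1)) ^ (2 * (d + 1)) * e3OfS (Lc ^ (n + 1 + 1 + 1)) (fun κ u => ((((Lc : ℝ) ^ (d + 1)) ^ (n - m) * (cVH * ((Lc : ℝ) ^ (m + 1 + 1)) ^ (d + 2))) •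
        pushSum (Lc ^ (m + 1 + 1 + 1)) (Lc ^ (n - m)) (borderInc d Lc (Lc ^ (m + 1 + 1)) κ u))) κ' u' x z a b -
      ((Lc : ℝ) ^ (n + 1 + 1)) ^ (2 * (d + 1)) * e3OfS (Lc ^ (n + 1 + 1)) (fun κ u => ((((Lc : ℝ) ^ (d + 1)) ^ (n - m) * (cVH * ((Lc : ℝ) ^ (m + 1)) ^ (d + 2))) •
        pushSum (Lc ^ (m + 1 + 1)) (Lc ^ (n - m)) (borderInc d Lc (Lc ^ (m + 1)) κ u))) κ' u' x z a b) (eV * θ ^ (n + 1) * ρ ^ (n - m)))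
    (dL : ∀ (n m : ℕ), m < n → ∀ (κ' : Fin (d + 1)) (u' : Fin (d + 1) → ℤ), SupBound (fun x z a b =>
      ((Lc : ℝ) ^ (n + 1 + 1 + 1)) ^ (2 * (d + 1)) * e3OfS (Lc ^ (n + 1 + 1 + 1)) (fun κ u => ((((Lc : ℝ) ^ (d + 1)) ^ (n - m) * (cΛ * ((Lc : ℝ) ^ (m + 1 + 1)) ^ (2 * d + 4))) •
        lagrInc d Lc (Lc ^ (m + 1 + 1)) (Lc ^ (m + 1 + 1 + 1)) κ u)) κ' u' x z a b -
      ((Lc : ℝ) ^ (n + 1 + 1)) ^ (2 * (d + 1)) * e3OfS (Lc ^ (n + 1 + 1)) (fun κ u => ((((Lc : ℝ) ^ (d + 1)) ^ (n - m) * (cΛ * ((Lc : ℝ) ^ (m + 1)) ^ (2 * d + 4))) •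
        lagrInc d Lc (Lc ^ (m + 1)) (Lc ^ (m + 1 + 1)) κ u)) κ' u' x z a b) (eL * θ ^ (n + 1) * ρ ^ (n - m))) :
    ∃ C₃ c₃ θ₃ δ₃ : ℝ, 0 < θ₃ ∧ θ₃ < 1 ∧ 0 < δ₃ ∧
      (∀ j : ℕ, LocStencil (unitS (sfStep Lc (j + 1)) (smStep d Lc (j + 1))
        (fun κ u => (cE * wE d Lc (j + 1)) • e3Of d Lc cE cVH cΛ (j + 1) κ u)) C₃ δ₃) ∧
      (∀ k j : ℕ, LocStencil (fun κ u =>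
          unitS (sfStep Lc (k + j + 1)) (smStep d Lc (k + j + 1))
              (fun κ u => (cE * wE d Lc (k + j + 1)) • e3Of d Lc cE cVH cΛ (k + j + 1) κ u) κ u -
            unitS (sfStep Lc (k + 1)) (smStep d Lc (k + 1))
              (fun κ u => (cE * wE d Lc (k + 1)) • e3Of d Lc cE cVH cΛ (k + 1) κ u) κ u) (c₃ * θ₃ ^ k) δ₃) := by
  obtain ⟨⟨C₃, δ₃, hδ₃, hE3⟩, ⟨c, hc, hR⟩⟩ := e3Shape_and_supRate_of_rows hLc cE cVH cΛ hδ hθ0.le hθ1 hρ0 hρ1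
    hW hV0 hL0 hVt hLt hV hL dW dVt dLt dV dL
  have hC₃ : 0 ≤ C₃ := ((hE3 0) 0 0).nonneg (Sum.inl 0)
  refine ⟨C₃, Real.sqrt (2 * (c / (1 - θ)) * C₃), Real.sqrt θ, δ₃ / 2, Real.sqrt_pos.2 hθ0,
    (Real.sqrt_lt' one_pos).2 (by simpa using hθ1), half_pos hδ₃, fun j => locStencil_mono (hE3 j) hC₃ (by linarith), fun k j => ?_⟩
  exact e3Drift_of_shape_supRate (d := d) (Lc := Lc) hE3 hR hc hθ0.le hθ1 k j


/-! ## §3 `d = 3`, `Lc ≥ 2`: the wall's S-rows from the twelve rows (K-slot inside by `KSlotAssembly.convCKWall_holds`) -/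

section Plug

variable {Lc : ℕ} [NeZero Lc]

/-- **THE WALL's S-ROWS `(hS, hSall)` FROM THE TWELVE ROWS** (`d = 3`, `2 ≤ Lc`, `0 < θ`) [folklore composition]: §2 at `d = 3`, then the row
owner's `StencilSlotOfE3.hS_of_e3` ∕ `hSall_of_e3` (K-slot inside) — in the literal shape of leaf-06's `StencilSlotWallPlug.hS_hSall_of_e3`.
NOTHING of the twelve rows is discharged here; with them, 3 of an2's 4 binder families of the wall would be theorems. -/
theorem hS_hSall_of_rows (hLc : 2 ≤ Lc) (cE cVH cΛ : ℝ)
    {δ θ ρ CW c₀V c₀L CtV CtL cV cL eW eVt eLt eV eL : ℝ} (hδ : 0 < δ) (hθ0 : 0 < θ) (hθ1 : θ < 1) (hρ0 : 0 ≤ ρ) (hρ1 : ρ < 1)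
    (hW : ∀ n : ℕ, LocStencil (fun κ' u' x' z' a b => ((Lc : ℝ) ^ (n + 1 + 1)) ^ (2 * (3 + 1)) *
      e3OfS (Lc ^ (n + 1 + 1)) (fun κ u => (cE * ((Lc : ℝ) ^ (3 + 1)) ^ (n + 1)) • wilsonA 3 κ u) κ' u' x' z' a b) CW δ)
    (hV0 : ∀ n : ℕ, LocStencil (fun κ' u' x' z' a b => ((Lc : ℝ) ^ (n + 1 + 1)) ^ (2 * (3 + 1)) *
      e3OfS (Lc ^ (n + 1 + 1)) (fun κ u => (((Lc : ℝ) ^ (3 + 1)) ^ (n + 1) * cVH) • pushSum Lc (Lc ^ (n + 1)) (mfNeg (vhS 3 Lc κ u)))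
        κ' u' x' z' a b) (c₀V * θ ^ (n + 1)) δ)
    (hL0 : ∀ n : ℕ, LocStencil (fun κ' u' x' z' a b => ((Lc : ℝ) ^ (n + 1 + 1)) ^ (2 * (3 + 1)) *
      e3OfS (Lc ^ (n + 1 + 1)) (fun κ u => (((Lc : ℝ) ^ (3 + 1)) ^ (n + 1) * cΛ) •
        SLam Lc (lamCoeffOf (KInv (N := Lc) (d := 3)) Lc) (fun μ y => hessFF Lc μ y) κ u) κ' u' x' z' a b) (c₀L * θ ^ (n + 1)) δ)
    (hVt : ∀ n : ℕ, LocStencil (fun κ' u' x' z' a b => ((Lc : ℝ) ^ (n + 1 + 1)) ^ (2 * (3 + 1)) *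
      e3OfS (Lc ^ (n + 1 + 1)) (fun κ u => (cVH * ((Lc : ℝ) ^ (n + 1)) ^ (3 + 2)) • borderInc 3 Lc (Lc ^ (n + 1)) κ u)
        κ' u' x' z' a b) CtV δ)
    (hLt : ∀ n : ℕ, LocStencil (fun κ' u' x' z' a b => ((Lc : ℝ) ^ (n + 1 + 1)) ^ (2 * (3 + 1)) *
      e3OfS (Lc ^ (n + 1 + 1)) (fun κ u => (cΛ * ((Lc : ℝ) ^ (n + 1)) ^ (2 * 3 + 4)) •
        lagrInc 3 Lc (Lc ^ (n + 1)) (Lc ^ (n + 1 + 1)) κ u) κ' u' x' z' a b) CtL δ)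
    (hV : ∀ n m : ℕ, m < n → LocStencil (fun κ' u' x' z' a b => ((Lc : ℝ) ^ (n + 1 + 1)) ^ (2 * (3 + 1)) *
      e3OfS (Lc ^ (n + 1 + 1)) (fun κ u => (((Lc : ℝ) ^ (3 + 1)) ^ (n - m) * (cVH * ((Lc : ℝ) ^ (m + 1)) ^ (3 + 2))) •
        pushSum (Lc ^ (m + 1 + 1)) (Lc ^ (n - m)) (borderInc 3 Lc (Lc ^ (m + 1)) κ u)) κ' u' x' z' a b) (cV * θ ^ (n - m)) δ)
    (hL : ∀ n m : ℕ, m < n → LocStencil (fun κ' u' x' z' a b => ((Lc : ℝ) ^ (n + 1 + 1)) ^ (2 * (3 + 1)) *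
      e3OfS (Lc ^ (n + 1 + 1)) (fun κ u => (((Lc : ℝ) ^ (3 + 1)) ^ (n - m) * (cΛ * ((Lc : ℝ) ^ (m + 1)) ^ (2 * 3 + 4))) •
        lagrInc 3 Lc (Lc ^ (m + 1)) (Lc ^ (m + 1 + 1)) κ u) κ' u' x' z' a b) (cL * θ ^ (n - m)) δ)
    (dW : ∀ (n : ℕ) (κ' : Fin (3 + 1)) (u' : Fin (3 + 1) → ℤ), SupBound (fun x z a b =>
      ((Lc : ℝ) ^ (n + 1 + 1 + 1)) ^ (2 * (3 + 1)) * e3OfS (Lc ^ (n + 1 + 1 + 1)) (fun κ u => (cE * ((Lc : ℝ) ^ (3 + 1)) ^ (n + 1 + 1)) • wilsonA 3 κ u) κ' u' x z a b -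
      ((Lc : ℝ) ^ (n + 1 + 1)) ^ (2 * (3 + 1)) * e3OfS (Lc ^ (n + 1 + 1)) (fun κ u => (cE * ((Lc : ℝ) ^ (3 + 1)) ^ (n + 1)) • wilsonA 3 κ u) κ' u' x z a b) (eW * θ ^ (n + 1)))
    (dVt : ∀ (n : ℕ) (κ' : Fin (3 + 1)) (u' : Fin (3 + 1) → ℤ), SupBound (fun x z a b =>
      ((Lc : ℝ) ^ (n + 1 + 1 + 1)) ^ (2 * (3 + 1)) * e3OfS (Lc ^ (n + 1 + 1 + 1)) (fun κ u => (cVH * ((Lc : ℝ) ^ (n + 1 + 1)) ^ (3 + 2)) • borderInc 3 Lc (Lc ^ (n + 1 + 1)) κ u) κ' u' x z a b -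
      ((Lc : ℝ) ^ (n + 1 + 1)) ^ (2 * (3 + 1)) * e3OfS (Lc ^ (n + 1 + 1)) (fun κ u => (cVH * ((Lc : ℝ) ^ (n + 1)) ^ (3 + 2)) • borderInc 3 Lc (Lc ^ (n + 1)) κ u) κ' u' x z a b) (eVt * θ ^ (n + 1)))
    (dLt : ∀ (n : ℕ) (κ' : Fin (3 + 1)) (u' : Fin (3 + 1) → ℤ), SupBound (fun x z a b =>
      ((Lc : ℝ) ^ (n + 1 + 1 + 1)) ^ (2 * (3 + 1)) * e3OfS (Lc ^ (n + 1 + 1 + 1)) (fun κ u => (cΛ * ((Lc : ℝ) ^ (n + 1 + 1)) ^ (2 * 3 + 4)) •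
        lagrInc 3 Lc (Lc ^ (n + 1 + 1)) (Lc ^ (n + 1 + 1 + 1)) κ u) κ' u' x z a b -
      ((Lc : ℝ) ^ (n + 1 + 1)) ^ (2 * (3 + 1)) * e3OfS (Lc ^ (n + 1 + 1)) (fun κ u => (cΛ * ((Lc : ℝ) ^ (n + 1)) ^ (2 * 3 + 4)) •
        lagrInc 3 Lc (Lc ^ (n + 1)) (Lc ^ (n + 1 + 1)) κ u) κ' u' x z a b) (eLt * θ ^ (n + 1)))
    (dV : ∀ (n m : ℕ), m < n → ∀ (κ' : Fin (3 + 1)) (u' : Fin (3 + 1) → ℤ), SupBound (fun x z a b =>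
      ((Lc : ℝ) ^ (n + 1 + 1 + 1)) ^ (2 * (3 + 1)) * e3OfS (Lc ^ (n + 1 + 1 + 1)) (fun κ u => ((((Lc : ℝ) ^ (3 + 1)) ^ (n - m) * (cVH * ((Lc : ℝ) ^ (m + 1 + 1)) ^ (3 + 2))) •
        pushSum (Lc ^ (m + 1 + 1 + 1)) (Lc ^ (n - m)) (borderInc 3 Lc (Lc ^ (m + 1 + 1)) κ u))) κ' u' x z a b -
      ((Lc : ℝ) ^ (n + 1 + 1)) ^ (2 * (3 + 1)) * e3OfS (Lc ^ (n + 1 + 1)) (fun κ u => ((((Lc : ℝ) ^ (3 + 1)) ^ (n - m) * (cVH * ((Lc : ℝ) ^ (m + 1)) ^ (3 + 2))) •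
        pushSum (Lc ^ (m + 1 + 1)) (Lc ^ (n - m)) (borderInc 3 Lc (Lc ^ (m + 1)) κ u))) κ' u' x z a b) (eV * θ ^ (n + 1) * ρ ^ (n - m)))
    (dL : ∀ (n m : ℕ), m < n → ∀ (κ' : Fin (3 + 1)) (u' : Fin (3 + 1) → ℤ), SupBound (fun x z a b =>
      ((Lc : ℝ) ^ (n + 1 + 1 + 1)) ^ (2 * (3 + 1)) * e3OfS (Lc ^ (n + 1 + 1 + 1)) (fun κ u => ((((Lc : ℝ) ^ (3 + 1)) ^ (n - m) * (cΛ * ((Lc : ℝ) ^ (m + 1 + 1)) ^ (2 * 3 + 4))) •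
        lagrInc 3 Lc (Lc ^ (m + 1 + 1)) (Lc ^ (m + 1 + 1 + 1)) κ u)) κ' u' x z a b -
      ((Lc : ℝ) ^ (n + 1 + 1)) ^ (2 * (3 + 1)) * e3OfS (Lc ^ (n + 1 + 1)) (fun κ u => ((((Lc : ℝ) ^ (3 + 1)) ^ (n - m) * (cΛ * ((Lc : ℝ) ^ (m + 1)) ^ (2 * 3 + 4))) •
        lagrInc 3 Lc (Lc ^ (m + 1)) (Lc ^ (m + 1 + 1)) κ u)) κ' u' x z a b) (eL * θ ^ (n + 1) * ρ ^ (n - m)))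
    (W : ℕ → Fin (3 + 1) → (Fin (3 + 1) → ℤ) → Fin (3 + 1) → (Fin (3 + 1) → ℤ) → MKer (3 + 1) (Fib 3))
    (Cw δw : ℕ → ℝ) (hδw : ∀ j, 0 < δw j) (hW' : ∀ j, VertexFamily₂ (W j) Lc (Cw j) (δw j)) :
    ∃ Cs cS θS δS : ℝ, 0 ≤ θS ∧ θS < 1 ∧ 0 < δS ∧
      (∀ j, LocStencil (unitS (sfStep Lc j) (smStep 3 Lc j) (JsBal0Of (one_le_of_two_le hLc) cE cVH cΛ W Cw δw hδw hW' j).S) Cs δS) ∧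
      (∀ k j, LocStencil (unitS (sfStep Lc (k + j)) (smStep 3 Lc (k + j))
          (JsBal0Of (one_le_of_two_le hLc) cE cVH cΛ W Cw δw hδw hW' (k + j)).S -
        unitS (sfStep Lc k) (smStep 3 Lc k) (JsBal0Of (one_le_of_two_le hLc) cE cVH cΛ W Cw δw hδw hW' k).S) (cS * θS ^ k) δS) := by
  obtain ⟨C₃, c₃, θ₃, δ₃, hθ₃, hθ₃1, hδ₃, hE3, hE3d⟩ := e3Shape_and_drift_of_rows (d := 3) (one_le_of_two_le hLc) cE cVH cΛ hδ hθ0 hθ1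
    hρ0 hρ1 hW hV0 hL0 hVt hLt hV hL dW dVt dLt dV dL
  obtain ⟨Cs, δ₁, hδ₁, hS⟩ := hS_of_e3 (Lc := Lc) hLc hE3 hδ₃ W Cw δw hδw hW'
  obtain ⟨cS, θS, δ₂, hθS0, hθS1, hδ₂, hSall⟩ := hSall_of_e3 (Lc := Lc) hLc hE3 hE3d hθ₃ hθ₃1 hδ₃ W Cw δw hδw hW'
  refine ⟨Cs, cS, θS, min δ₁ δ₂, hθS0, hθS1, lt_min hδ₁ hδ₂, fun j => ?_, fun k j => ?_⟩
  · exact locStencil_mono (hS j) (((hS j) 0 0).nonneg (Sum.inl 0)) (min_le_left _ _)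
  · exact locStencil_mono (hSall k j) (((hSall k j) 0 0).nonneg (Sum.inl 0)) (min_le_right _ _)

end Plug

end Summit.QuantumFields.BalabanUV.Beta.GAN24.StencilSlotE3Tables
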